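import Mathlib.Analysis.SpecialFunctions.Pow.Real
import Mathlib.Algebra.Order.BigOperators.Group.Finset
import Mathlib.Tactic.Ring
import Mathlib.Tactic.Linarith
import Mathlib.Tactic.Positivity
import Mathlib.Tactic.FieldSimp

/-!
# A submultiplicative sequence beaten at ONE scale decays geometrically at all scales

Helper file for the crux `QuadrupoleSelectionRule` (stmt-CriticalPhenomena-7029, informal) of route
`CardyFlipRusso` (sub-problem `CardyFormulaZ2`), line `Sketch`: the first lemma
`SubmultiplicativeRate` of the crux idea card `fixed-modulus-pair-memory` (ideator 2), in the
sharp form.  If `a ≥ 0` is quasi-submultiplicative, `a (m + n) ≤ C · a m · a n` with `C ≥ 1`, and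
at a single scale `n₀ > 0` the normalised value is below the target rate, `C · a n₀ ≤ ρ^{n₀}`
(`ρ > 0`), then `a n ≤ C'' ρⁿ` for all `n`.  (The card asks only for the rate `ρ · C^{1/n₀} ≥ ρ`.)
This is the "fixed modulus input ⟹ all-scale decay" mechanism: a gap certified at one mesoscopic
scale (e.g. for CLE₆, by computation or by an SLE estimate) propagates.
-/

namespace Summit.CriticalPhenomena.CardyFormulaZ2.Theorems

/-- Block iteration of a quasi-submultiplicative bound: `C · a (n₀ k + r) ≤ (ρ^{n₀})^k · (C · a r)`
when `C · a n₀ ≤ ρ^{n₀}`. [folklore] -/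
theorem mul_apply_block_le (a : ℕ → ℝ) (C ρ : ℝ) (n₀ : ℕ) (hC : 1 ≤ C) (hρ : 0 < ρ)
    (ha : ∀ n, 0 ≤ a n) (hsub : ∀ m n, a (m + n) ≤ C * a m * a n) (hgap : C * a n₀ ≤ ρ ^ n₀)
    (k r : ℕ) : C * a (n₀ * k + r) ≤ (ρ ^ n₀) ^ k * (C * a r) := by
  have hC0 : 0 ≤ C := le_trans zero_le_one hC
  induction k with
  | zero => simp
  | succ k ih =>
    have hidx : n₀ * (k + 1) + r = (n₀ * k + r) + n₀ := by ring
    have hρk : 0 ≤ (ρ ^ n₀) ^ k := by positivity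
    calc C * a (n₀ * (k + 1) + r) = C * a ((n₀ * k + r) + n₀) := by rw [hidx]
      _ ≤ C * (C * a (n₀ * k + r) * a n₀) :=
          mul_le_mul_of_nonneg_left (hsub _ _) hC0
      _ = (C * a (n₀ * k + r)) * (C * a n₀) := by ring
      _ ≤ ((ρ ^ n₀) ^ k * (C * a r)) * ρ ^ n₀ :=
          mul_le_mul ih hgap (mul_nonneg hC0 (ha _)) (mul_nonneg hρk (mul_nonneg hC0 (ha _)))
      _ = (ρ ^ n₀) ^ (k + 1) * (C * a r) := by ring

/-- **`SubmultiplicativeRate` (card `fixed-modulus-pair-memory`, first lemma; sharp form).** A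
nonnegative quasi-submultiplicative sequence (`a (m + n) ≤ C · a m · a n`, `C ≥ 1`) whose
normalised value at one scale `n₀ > 0` is below the target, `C · a n₀ ≤ ρ^{n₀}` with `ρ > 0`,
satisfies `a n ≤ C'' ρⁿ` for all `n`, with `C'' = ∑_{r < n₀} a r / ρ^r`. [folklore] -/
theorem submultiplicative_rate (a : ℕ → ℝ) (C ρ : ℝ) (n₀ : ℕ) (hC : 1 ≤ C) (hn₀ : 0 < n₀)
    (hρ : 0 < ρ) (ha : ∀ n, 0 ≤ a n) (hsub : ∀ m n, a (m + n) ≤ C * a m * a n)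
    (hgap : C * a n₀ ≤ ρ ^ n₀) :
    ∃ C'' : ℝ, ∀ n, a n ≤ C'' * ρ ^ n := by
  refine ⟨∑ r ∈ Finset.range n₀, a r / ρ ^ r, fun n => ?_⟩
  have hC0 : 0 < C := lt_of_lt_of_le zero_lt_one hC
  set k := n / n₀ with hk
  set r := n % n₀ with hr
  have hn : n = n₀ * k + r := (Nat.div_add_mod n n₀).symm
  have hrlt : r < n₀ := Nat.mod_lt n hn₀
  have hblock := mul_apply_block_le a C ρ n₀ hC hρ ha hsub hgap k r
  -- `a n ≤ ρ^{n₀ k} a r`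
  have h1 : a n ≤ (ρ ^ n₀) ^ k * a r := by
    rw [hn]
    have := hblock
    nlinarith [ha (n₀ * k + r), ha r, pow_nonneg (pow_nonneg hρ.le n₀) k]
  -- `ρ^{n₀ k} a r = ρ^n · (a r / ρ^r) ≤ ρ^n · C''`
  have hρr : 0 < ρ ^ r := pow_pos hρ r
  have h2 : (ρ ^ n₀) ^ k * a r = ρ ^ n * (a r / ρ ^ r) := by
    rw [hn, pow_add, pow_mul]
    field_simp
  have hterm : a r / ρ ^ r ≤ ∑ r' ∈ Finset.range n₀, a r' / ρ ^ r' :=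
    Finset.single_le_sum (f := fun r' => a r' / ρ ^ r') (fun r' _ => div_nonneg (ha r') (pow_nonneg hρ.le r'))
      (Finset.mem_range.2 hrlt)
  calc a n ≤ (ρ ^ n₀) ^ k * a r := h1
    _ = ρ ^ n * (a r / ρ ^ r) := h2
    _ ≤ ρ ^ n * ∑ r' ∈ Finset.range n₀, a r' / ρ ^ r' :=
        mul_le_mul_of_nonneg_left hterm (pow_nonneg hρ.le n)
    _ = (∑ r' ∈ Finset.range n₀, a r' / ρ ^ r') * ρ ^ n := by ring

/-- The card's form of the conclusion: the rate `ρ · C^{1/n₀}` (which is `≥ ρ` as `C ≥ 1`) is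
achieved a fortiori. [folklore] -/
theorem submultiplicative_rate' (a : ℕ → ℝ) (C ρ : ℝ) (n₀ : ℕ) (hC : 1 ≤ C) (hn₀ : 0 < n₀)
    (hρ : 0 < ρ) (ha : ∀ n, 0 ≤ a n) (hsub : ∀ m n, a (m + n) ≤ C * a m * a n)
    (hgap : C * a n₀ ≤ ρ ^ n₀) :
    ∃ C'' : ℝ, ∀ n, a n ≤ C'' * (ρ * C ^ (1 / (n₀ : ℝ))) ^ n := by
  obtain ⟨C'', hC''⟩ := submultiplicative_rate a C ρ n₀ hC hn₀ hρ ha hsub hgap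
  refine ⟨max C'' 0, fun n => ?_⟩
  have hρn : ρ ^ n ≤ (ρ * C ^ (1 / (n₀ : ℝ))) ^ n := by
    have h1 : (1 : ℝ) ≤ C ^ (1 / (n₀ : ℝ)) := Real.one_le_rpow hC (by positivity)
    exact pow_le_pow_left₀ hρ.le (by nlinarith) n
  calc a n ≤ C'' * ρ ^ n := hC'' n
    _ ≤ max C'' 0 * ρ ^ n := mul_le_mul_of_nonneg_right (le_max_left _ _) (pow_nonneg hρ.le n)
    _ ≤ max C'' 0 * (ρ * C ^ (1 / (n₀ : ℝ))) ^ n :=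
        mul_le_mul_of_nonneg_left hρn (le_max_right _ _)

end Summit.CriticalPhenomena.CardyFormulaZ2.Theorems
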